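import Summits.AtomisticToContinuum.HydrodynamicLimit.Theorems.JParityClosureLocalSecondLawEquilibriumDefs
import Literature.MathematicalPhysics.KineticTheory.HardSphereUniformGasShift
import Literature.MathematicalPhysics.KineticTheory.HardSphereEulerProofs

/-!
# Equilibrium stub `eq_uniformMarginal`: the one-particle position marginal of the homogeneous law is Haar

Registered stub of the equilibrium side-composition of line `exact-entropy-ledger-three-passivities` for the crux
`JParityClosure.LocalSecondLaw` (stmt-AtomisticToContinuum-13081, lead c2).  For the homogeneous local Gibbs law
`lawC σ a Θ ū N Φ` (constant activity `a > 0`, temperature `Θ > 0`, drift `ū`; `N + 1` hard spheres of diameter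
`σ(N+1)^{-1/3}` on `𝕋³`, `σ ≤ 1/2`) and every measurable `f : 𝕋³ → [0, ∞]`,
`E[∑ᵢ f(xᵢ)] = (N + 1) ∫ f d(Haar)`: the one-particle POSITION marginal is uniform.

Proof: position events have the probability of the configurational Gibbs measure
`P = posGibbsMeasure a ε (N+1)` (`localGibbsLaw_posEvent`), a probability measure (`σ ≤ 1/2`) whose density
`Z⁻¹ 𝟙[no overlap] a^{N+1}` and reference measure (Haar on `(𝕋³)^{N+1}`) are invariant under the diagonal shift
`x ↦ x + (c, …, c)`; averaging over `c ∈ 𝕋³` (total Haar mass `1`), Tonelli, and `∫ f(xᵢ + c) dc = ∫ f`.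

References: H. Spohn, *Large Scale Dynamics of Interacting Particles* (1991), Part I §2.3 (homogeneous Gibbs law).
-/

noncomputable section

namespace Summit.AtomisticToContinuum.HydrodynamicLimit.Theorems.LocalSecondLawEquilibrium

open scoped BigOperators Topology Classical MeasureTheory ENNReal InnerProductSpace
open Filter Set MeasureTheory
open Literature.MathematicalPhysics.KineticTheory
open Literature.Analysis.FluidPDE
open Summit.AtomisticToContinuum.HydrodynamicLimit.Theorems.LocalSecondLawNegative
open Summit.AtomisticToContinuum.HydrodynamicLimit.Theorems.LocalSecondLawLedger

/-- **Translation invariance of the configurational Gibbs measure, `lintegral` form** (constant activity):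
`∫⁻ F(x + (c,…,c)) dP = ∫⁻ F dP` for measurable `F ≥ 0` (Haar measure of `(𝕋³)ⁿ` and the density
`Z⁻¹ 𝟙[no overlap] aⁿ` are shift invariant). -/
theorem lintegral_posGibbsMeasure_add_const (a ε : ℝ) (n : ℕ) (c : T3) {F : (Fin n → T3) → ℝ≥0∞}
    (hF : Measurable F) :
    ∫⁻ x, F (x + fun _ => c) ∂posGibbsMeasure (fun _ : T3 => a) ε n =
      ∫⁻ x, F x ∂posGibbsMeasure (fun _ : T3 => a) ε n := by
  set ρ : (Fin n → T3) → ℝ≥0∞ := fun x =>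
    ENNReal.ofReal ((posPartition (fun _ : T3 => a) ε n)⁻¹ * posWeight (fun _ : T3 => a) ε n x) with hρ
  have hρm : Measurable ρ := (measurable_const.mul (measurable_posWeight continuous_const ε n)).ennreal_ofReal
  have hρc : ∀ x, ρ (x + fun _ => c) = ρ x := fun x => by
    simp only [hρ, posWeight_const_add_const]
  haveI : (volume : Measure (Fin n → T3)).IsAddRightInvariant :=
    Measure.pi.isAddRightInvariant (fun _ : Fin n => (volume : Measure T3))
  have hFc : Measurable fun x : Fin n → T3 => F (x + fun _ => c) := hF.comp (measurable_add_const _)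
  show ∫⁻ x, F (x + fun _ => c) ∂(volume.withDensity ρ) = ∫⁻ x, F x ∂(volume.withDensity ρ)
  rw [lintegral_withDensity_eq_lintegral_mul _ hρm hFc, lintegral_withDensity_eq_lintegral_mul _ hρm hF]
  have e : (ρ * fun x : Fin n → T3 => F (x + fun _ => c)) =
      fun x : Fin n → T3 => (ρ * F) (x + fun _ => c) := by
    funext x
    simp only [Pi.mul_apply, hρc]
  rw [e]
  exact lintegral_add_right_eq_self (μ := (volume : Measure (Fin n → T3))) (ρ * F) (fun _ => c)

/-- **The one-particle position marginal of `P_N` is Haar**: `∫⁻ ∑ᵢ f(xᵢ) dP = (N+1) ∫⁻ f` for the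
configurational Gibbs measure of constant activity at `σ ≤ 1/2` (average the shift invariance over the shift,
Tonelli, `∫⁻ f(xᵢ + c) dc = ∫⁻ f`). -/
theorem lintegral_sum_posGibbsMeasure_const {a σ : ℝ} (ha : 0 < a) (hσ2 : σ ≤ 1 / 2) (N : ℕ)
    {f : T3 → ℝ≥0∞} (hf : Measurable f) :
    ∫⁻ x, ∑ i, f (x i) ∂posGibbsMeasure (fun _ : T3 => a) (hsDiameter σ N) (N + 1) =
      ((N + 1 : ℕ) : ℝ≥0∞) * ∫⁻ y : T3, f y := by
  set P := posGibbsMeasure (fun _ : T3 => a) (hsDiameter σ N) (N + 1)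
  haveI : IsProbabilityMeasure P := isProbabilityMeasure_posGibbsMeasure continuous_const (fun _ => ha) hσ2 N
  have hF : Measurable fun x : Fin (N + 1) → T3 => ∑ i, f (x i) :=
    Finset.measurable_sum _ fun i _ => hf.comp (measurable_pi_apply i)
  -- shift by every `c`
  have step1 : ∀ c : T3, ∫⁻ x, ∑ i, f (x i) ∂P = ∫⁻ x, ∑ i, f (x i + c) ∂P := fun c => by
    have h := lintegral_posGibbsMeasure_add_const a (hsDiameter σ N) (N + 1) c hF
    simp only [Pi.add_apply] at h
    exact h.symm
  -- average over the shift
  have step2 : ∫⁻ x, ∑ i, f (x i) ∂P = ∫⁻ c : T3, ∫⁻ x, ∑ i, f (x i + c) ∂P := by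
    simp_rw [← step1]
    rw [lintegral_const, measure_univ, mul_one]
  have hm : AEMeasurable (Function.uncurry fun (c : T3) (x : Fin (N + 1) → T3) => ∑ i, f (x i + c))
      ((volume : Measure T3).prod P) := by
    refine Measurable.aemeasurable ?_
    show Measurable fun p : T3 × (Fin (N + 1) → T3) => ∑ i, f (p.2 i + p.1)
    exact Finset.measurable_sum _ fun i _ =>
      hf.comp (((measurable_pi_apply i).comp measurable_snd).add measurable_fst)
  rw [step2, lintegral_lintegral_swap hm]
  have inner : ∀ x : Fin (N + 1) → T3,
      ∫⁻ c : T3, ∑ i, f (x i + c) = ((N + 1 : ℕ) : ℝ≥0∞) * ∫⁻ y : T3, f y := fun x => by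
    rw [lintegral_finsetSum Finset.univ (f := fun i (c : T3) => f (x i + c)) fun i _ =>
        hf.comp (measurable_const_add (x i))]
    simp_rw [lintegral_add_left_eq_self]
    rw [Finset.sum_const, Finset.card_univ, Fintype.card_fin, nsmul_eq_mul]
  simp_rw [inner]
  rw [lintegral_const, measure_univ, mul_one]

/-- **Stub `eq_uniformMarginal`.** The one-particle position marginal of the homogeneous hard-sphere law
`lawC σ a Θ ū N Φ` is Haar on `𝕋³`: `E[∑ᵢ f(xᵢ)] = (N + 1) ∫ f` for every measurable `f ≥ 0`. -/
theorem eq_uniformMarginal :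
  ∀ (a Θ σ : ℝ) (ū : V3), 0 < a → 0 < Θ → 0 < σ → σ ≤ 1 / 2 → ∀ (N : ℕ) (Φ : Flow σ N) (f : T3 → ℝ≥0∞),
    Measurable f → ∫⁻ z, ∑ i : Fin (N + 1), f (z i).1 ∂(lawC σ a Θ ū N Φ) = ((N + 1 : ℕ) : ℝ≥0∞) * ∫⁻ y : T3, f y := by
  intro a Θ σ ū ha hΘ _hσ hσ2 N Φ f hf
  have hposm : Measurable fun z : Phase N => fun i => (z i).1 :=
    measurable_pi_lambda _ fun i => (measurable_pi_apply i).fst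
  have hmap : (lawC σ a Θ ū N Φ).map (fun z : Phase N => fun i => (z i).1) =
      posGibbsMeasure (fun _ : T3 => a) (hsDiameter σ N) (N + 1) := by
    refine Measure.ext fun S hS => ?_
    rw [Measure.map_apply hposm hS]
    exact localGibbsLaw_posEvent σ ha.le hΘ ū N Φ hS
  have hF : Measurable fun x : Fin (N + 1) → T3 => ∑ i, f (x i) :=
    Finset.measurable_sum _ fun i _ => hf.comp (measurable_pi_apply i)
  rw [← lintegral_sum_posGibbsMeasure_const ha hσ2 N hf, ← hmap, lintegral_map hF hposm]

end Summit.AtomisticToContinuum.HydrodynamicLimit.Theorems.LocalSecondLawEquilibrium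

end
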